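import Summits.NavierStokesRegularity.NavierStokesRegularity.Theorems.CoriolisHeadNoCoRotatingCoreNormalForm
import Summits.NavierStokesRegularity.NavierStokesRegularity.Theorems.CoriolisHeadTypeIRateTransport
import Literature.Analysis.FluidPDE.IsometryInvariance
import Literature.Analysis.FluidPDE.AncientSimilarityVariables
import Literature.Analysis.FluidPDE.TypeIAncientMildRssPullback
import HarnessLib

/-!
# CoriolisHeadLocalEnergyPhysicalField — crux `NoCoRotatingCore` (stmt-NavierStokesRegularity-22676), line
# `local_energy_rescue` v2.1 (crux workfile, ns-idea-10 g3; unregistered), stub S3a `stub_localEnergyClass` —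
# file 1: the PHYSICAL rotated self-similar field of a general-frame profile is a classical solution on the past

For a smooth solution `(U, P)` of the rotated Leray profile system in a GENERAL frame
`−νΔU + aU + a DU[y] + (BU − DU[By]) + DU[U] + ∇P = 0`, `div U = 0` (`ν, a > 0`, `B` skew), the physical
field of stubs S3a/S3b of the line,
`u(t,x) = λ e^{θB} U(λ e^{−θB} x)`, `λ = (2a(0 − t))^{−1/2}`, `θ = a⁻¹ log λ` (`e^{cB} = NormedSpace.exp (c • B)`),
is a classical Navier–Stokes solution (viscosity `ν`, no force) on the time set `(−∞, 0)` with the pressure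
`p(t,x) = λ² P(λ e^{−θB} x)`.

Route.  `u = ofLerayOrbit W` for the ROTATING ORBIT `W(s,y) = e^{φ(s)B} W₀(e^{−φ(s)B} y)`,
`φ(s) = c²s − c² log(2a)`, of the DILATED profile `W₀(z) = c U(cz)`, `Q₀(z) = c² P(cz)`, `c = (2a)^{−1/2}`, which
solves the `(ν, ½, c²B)` profile system (tree `rotatedProfileSystem_dilate`); the orbit solves the backward Leray
system on `ℝ × ℝ³` (this file: the `e^{θB}` version of the tree's `classicalOfProfile_isBackwardLeraySolutionOn`,
every spatial term conjugated by the linear isometry `e^{φ(s)B}` (`IsometryInvariance`, `rss_exists_rot`), the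
`s`-derivative being `e^{φB} c²(BW₀ − DW₀[B·])`), and the tree's `isClassicalNSSolutionOn_Iio_ofLerayOrbit_iff`
turns that into a classical solution on the past.

* `contDiff_exp_smul`, `contDiff_exp_smul_apply` — smoothness of the one-parameter group `c ↦ e^{cB}`;
* `hasDerivAt_exp_conj` — `d/dc e^{cB} W₀(e^{−cB} y) = e^{cB}(BW₀ − DW₀[B·])(e^{−cB} y)`;
* `orbit_isBackwardLeraySolutionOn` — the rotating orbit of a `(ν, ½, κB)` profile solves the backward Leray system;
* `physicalField_eq_ofLerayOrbit`, `isClassicalNSSolutionOn_physicalField` — the dictionary for the field of S3a/S3b.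

HONEST FRAMING.  Helper for an unregistered line's stub (S3a); nothing here proves `NoCoRotatingCore`, Pineau–Vicol's
Conjecture 1.1 or NS regularity.

References: B. Pineau, V. Vicol, arXiv:2607.09619, (1.7)–(1.8) [PineauVicol2026]; D. Chae, J. Wolf, arXiv:1610.09464, §4
[ChaeWolf2017RemovingDSS]; line card `Cruxes/NoCoRotatingCore/Lines/local_energy_rescue.md` (S3a).
-/

noncomputable section

open MeasureTheory Set Function Filter Topology Metric InnerProductSpace Real
open scoped RealInnerProductSpace Laplacian ContDiff Topology

-- the summit and its single sub-problem share the name (CONVENTIONS §1), as in every Theorems file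
set_option linter.dupNamespace false
-- nested operator types `ℝ³ →L[ℝ] ℝ³` inside the Banach algebra `ℝ³ →L[ℝ] ℝ³` (as in `CoriolisHeadTypeIRateTransport`)
set_option maxSynthPendingDepth 3

namespace Summit.NavierStokesRegularity.NavierStokesRegularity.Theorems.CoriolisHead

namespace LocalEnergyRescue

open Literature.Analysis.FluidPDE

/-! ## §1 The one-parameter group `c ↦ e^{cB}` -/

/-- `c ↦ e^{cB}` is smooth (the exponential of a Banach algebra is analytic). [folklore] -/
theorem contDiff_exp_smul (B : EuclideanSpace ℝ (Fin 3) →L[ℝ] EuclideanSpace ℝ (Fin 3)) {n : WithTop ℕ∞} :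
    ContDiff ℝ n (fun c : ℝ => NormedSpace.exp (c • B)) := by
  have hexp : ContDiff ℝ n
      (NormedSpace.exp : (EuclideanSpace ℝ (Fin 3) →L[ℝ] EuclideanSpace ℝ (Fin 3)) →
        (EuclideanSpace ℝ (Fin 3) →L[ℝ] EuclideanSpace ℝ (Fin 3))) :=
    (AnalyticOnNhd.contDiff (fun x _ => NormedSpace.exp_analytic (𝕂 := ℝ) x)).of_le le_top
  exact hexp.comp (contDiff_id.smul contDiff_const)

/-- Joint smoothness of `z ↦ e^{θ(z)B} W(z)` for smooth `θ`, `W`. [folklore] -/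
theorem contDiff_exp_smul_apply (B : EuclideanSpace ℝ (Fin 3) →L[ℝ] EuclideanSpace ℝ (Fin 3))
    {X : Type*} [NormedAddCommGroup X] [NormedSpace ℝ X] {n : WithTop ℕ∞} {θ : X → ℝ}
    {W : X → EuclideanSpace ℝ (Fin 3)} (hθ : ContDiff ℝ n θ) (hW : ContDiff ℝ n W) :
    ContDiff ℝ n (fun z => NormedSpace.exp (θ z • B) (W z)) :=
  ((contDiff_exp_smul B).comp hθ).clm_apply hW

/-- **The derivative of the conjugated profile in the group parameter**: for differentiable `W₀`,
`d/dc [e^{cB} W₀(e^{−cB} y)] = e^{cB} (B W₀(z) − DW₀(z)[Bz])`, `z = e^{−cB} y` (`B` commutes with `e^{±cB}`).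
[folklore] -/
theorem hasDerivAt_exp_conj (B : EuclideanSpace ℝ (Fin 3) →L[ℝ] EuclideanSpace ℝ (Fin 3))
    {W₀ : EuclideanSpace ℝ (Fin 3) → EuclideanSpace ℝ (Fin 3)} (hW₀ : Differentiable ℝ W₀) (c : ℝ)
    (y : EuclideanSpace ℝ (Fin 3)) :
    HasDerivAt (fun c' : ℝ => NormedSpace.exp (c' • B) (W₀ (NormedSpace.exp ((-c') • B) y)))
      (NormedSpace.exp (c • B) (B (W₀ (NormedSpace.exp ((-c) • B) y)) -
        fderiv ℝ W₀ (NormedSpace.exp ((-c) • B) y) (B (NormedSpace.exp ((-c) • B) y)))) c := by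
  -- the inner characteristic `c' ↦ e^{−c'B} y`
  have hin : HasDerivAt (fun c' : ℝ => NormedSpace.exp ((-c') • B) y)
      (-(B (NormedSpace.exp ((-c) • B) y))) c := by
    have h := (TypeIRate.hasDerivAt_flow B y (-c)).scomp c (hasDerivAt_neg c)
    simpa [Function.comp_def, neg_one_smul] using h
  have hW : HasDerivAt (fun c' : ℝ => W₀ (NormedSpace.exp ((-c') • B) y))
      (fderiv ℝ W₀ (NormedSpace.exp ((-c) • B) y) (-(B (NormedSpace.exp ((-c) • B) y)))) c :=
    (hW₀ _).hasFDerivAt.comp_hasDerivAt c hin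
  have hE := hasDerivAt_exp_smul_const' (𝕂 := ℝ) B c
  have h := hE.clm_apply hW
  refine h.congr_deriv ?_
  have e1 : (B * NormedSpace.exp (c • B)) (W₀ (NormedSpace.exp ((-c) • B) y)) =
      NormedSpace.exp (c • B) (B (W₀ (NormedSpace.exp ((-c) • B) y))) := by
    show B (NormedSpace.exp (c • B) (W₀ (NormedSpace.exp ((-c) • B) y))) = _
    rw [TypeIRate.exp_smul_apply_comm]
  rw [e1, map_neg, map_neg, map_sub, sub_eq_add_neg]

/-! ## §2 The rotating orbit of a profile solves the backward Leray system -/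

section Orbit

variable {ν κ θ₀ : ℝ} {B : EuclideanSpace ℝ (Fin 3) →L[ℝ] EuclideanSpace ℝ (Fin 3)}
  {W₀ : EuclideanSpace ℝ (Fin 3) → EuclideanSpace ℝ (Fin 3)} {Q₀ : EuclideanSpace ℝ (Fin 3) → ℝ}

/-- The `s`-derivative of the rotating orbit `W(s,y) = e^{(κs+θ₀)B} W₀(e^{−(κs+θ₀)B} y)`:
`∂ₛW(s,y) = e^{(κs+θ₀)B} ((κB) W₀(z) − DW₀(z)[(κB) z])`, `z = e^{−(κs+θ₀)B} y`. [folklore] -/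
theorem hasDerivAt_orbit (hW₀ : Differentiable ℝ W₀) (s : ℝ) (y : EuclideanSpace ℝ (Fin 3)) :
    HasDerivAt (fun s' : ℝ => NormedSpace.exp ((κ * s' + θ₀) • B) (W₀ (NormedSpace.exp ((-(κ * s' + θ₀)) • B) y)))
      (NormedSpace.exp ((κ * s + θ₀) • B) ((κ • B) (W₀ (NormedSpace.exp ((-(κ * s + θ₀)) • B) y)) -
        fderiv ℝ W₀ (NormedSpace.exp ((-(κ * s + θ₀)) • B) y)
          ((κ • B) (NormedSpace.exp ((-(κ * s + θ₀)) • B) y)))) s := by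
  have hφ : HasDerivAt (fun s' : ℝ => κ * s' + θ₀) κ s := by
    simpa using ((hasDerivAt_id s).const_mul κ).add_const θ₀
  have h := (hasDerivAt_exp_conj B hW₀ (κ * s + θ₀) y).scomp s hφ
  refine h.congr_deriv ?_
  have hκB : ∀ v : EuclideanSpace ℝ (Fin 3), (κ • B) v = κ • B v := fun v => rfl
  simp only [hκB, map_smul, smul_sub, map_sub]

/-- Joint smoothness of the rotating orbit `(s,y) ↦ e^{(κs+θ₀)B} W₀(e^{−(κs+θ₀)B} y)` for `W₀ ∈ C^∞`. [folklore] -/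
theorem isSmoothSpaceTimeOn_orbit (hW₀ : ContDiff ℝ ∞ W₀) :
    IsSmoothSpaceTimeOn univ (fun (s : ℝ) (y : EuclideanSpace ℝ (Fin 3)) =>
      NormedSpace.exp ((κ * s + θ₀) • B) (W₀ (NormedSpace.exp ((-(κ * s + θ₀)) • B) y))) := by
  have hθ : ContDiff ℝ ∞ (fun z : ℝ × EuclideanSpace ℝ (Fin 3) => κ * z.1 + θ₀) :=
    (contDiff_const.mul contDiff_fst).add contDiff_const
  have hin : ContDiff ℝ ∞ (fun z : ℝ × EuclideanSpace ℝ (Fin 3) =>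
      NormedSpace.exp ((-(κ * z.1 + θ₀)) • B) z.2) :=
    contDiff_exp_smul_apply B hθ.neg contDiff_snd
  have hV : ContDiff ℝ ∞ (fun z : ℝ × EuclideanSpace ℝ (Fin 3) =>
      NormedSpace.exp ((κ * z.1 + θ₀) • B) (W₀ (NormedSpace.exp ((-(κ * z.1 + θ₀)) • B) z.2))) :=
    contDiff_exp_smul_apply B hθ (hW₀.comp hin)
  exact hV.contDiffOn

/-- Joint smoothness of the rotating pressure orbit `(s,y) ↦ Q₀(e^{−(κs+θ₀)B} y)` for `Q₀ ∈ C^∞`. [folklore] -/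
theorem isSmoothSpaceTimeOn_orbitPressure (hQ₀ : ContDiff ℝ ∞ Q₀) :
    IsSmoothSpaceTimeOn univ (fun (s : ℝ) (y : EuclideanSpace ℝ (Fin 3)) =>
      Q₀ (NormedSpace.exp ((-(κ * s + θ₀)) • B) y)) := by
  have hθ : ContDiff ℝ ∞ (fun z : ℝ × EuclideanSpace ℝ (Fin 3) => κ * z.1 + θ₀) :=
    (contDiff_const.mul contDiff_fst).add contDiff_const
  have hin : ContDiff ℝ ∞ (fun z : ℝ × EuclideanSpace ℝ (Fin 3) =>
      NormedSpace.exp ((-(κ * z.1 + θ₀)) • B) z.2) :=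
    contDiff_exp_smul_apply B hθ.neg contDiff_snd
  exact (hQ₀.comp hin).contDiffOn

/-- **The rotating orbit of a `(ν, ½, κB)` profile solves the backward Leray system.**  If `(W₀, Q₀)` is a smooth
divergence-free solution of `−νΔW₀ + ½W₀ + ½DW₀[z] + ((κB)W₀ − DW₀[(κB)z]) + DW₀[W₀] + ∇Q₀ = 0` with `B` skew, then
`W(s,y) = e^{(κs+θ₀)B} W₀(e^{−(κs+θ₀)B} y)`, `Q(s,y) = Q₀(e^{−(κs+θ₀)B} y)` solve the backward Leray system
`∂ₛW − νΔW + ½W + ½DW[y] + DW[W] + ∇Q = 0`, `div W = 0` on `ℝ × ℝ³`: every spatial term at `y` is the linear isometry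
`e^{(κs+θ₀)B}` applied to the corresponding term for `(W₀, Q₀)` at `e^{−(κs+θ₀)B} y` (`IsometryInvariance`), and `∂ₛW` is
`e^{(κs+θ₀)B}` applied to `(κB)W₀ − DW₀[(κB)·]` there.  (The `e^{θB}` version of the tree's
`classicalOfProfile_isBackwardLeraySolutionOn`.) [cite: PineauVicol2026, (1.7)–(1.8) (arXiv:2607.09619 p. 3)] -/
theorem orbit_isBackwardLeraySolutionOn (hW₀ : ContDiff ℝ ∞ W₀) (hQ₀ : ContDiff ℝ ∞ Q₀)
    (hB : ∀ x, inner ℝ (B x) x = 0) (hdiv : VectorCalculus.IsDivFree W₀)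
    (heq : ∀ z, -(ν • (Δ W₀) z) + (1 / 2 : ℝ) • W₀ z + (1 / 2 : ℝ) • fderiv ℝ W₀ z z
      + ((κ • B) (W₀ z) - fderiv ℝ W₀ z ((κ • B) z)) + convect W₀ W₀ z + gradient Q₀ z = 0) :
    IsBackwardLeraySolutionOn univ ν
      (fun (s : ℝ) (y : EuclideanSpace ℝ (Fin 3)) =>
        NormedSpace.exp ((κ * s + θ₀) • B) (W₀ (NormedSpace.exp ((-(κ * s + θ₀)) • B) y)))
      (fun (s : ℝ) (y : EuclideanSpace ℝ (Fin 3)) => Q₀ (NormedSpace.exp ((-(κ * s + θ₀)) • B) y)) := by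
  have hW₀d : Differentiable ℝ W₀ := hW₀.differentiable (by simp)
  refine IsBackwardLeraySolutionOn.of_leray (isSmoothSpaceTimeOn_orbit hW₀) (isSmoothSpaceTimeOn_orbitPressure hQ₀)
    (fun s _ y => ?_) (fun s _ => ?_)
  · -- the slice at time `s` is the conjugate of `(W₀, Q₀)` by the linear isometry `R = e^{(κs+θ₀)B}`
    obtain ⟨L, hL, hLs⟩ := rss_exists_rot hB (κ * s + θ₀)
    set R : EuclideanSpace ℝ (Fin 3) ≃ₗᵢ[ℝ] EuclideanSpace ℝ (Fin 3) := L.symm with hR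
    have hRa : ∀ v, NormedSpace.exp ((κ * s + θ₀) • B) v = R v := fun v => (hLs v).symm
    have hRs : ∀ v, NormedSpace.exp ((-(κ * s + θ₀)) • B) v = R.symm v := fun v => by
      rw [hR, LinearIsometryEquiv.symm_symm]; exact (hL v).symm
    have hslice : (fun y' : EuclideanSpace ℝ (Fin 3) =>
        NormedSpace.exp ((κ * s + θ₀) • B) (W₀ (NormedSpace.exp ((-(κ * s + θ₀)) • B) y'))) =
        fun y' => R (W₀ (R.symm y')) := funext fun y' => by rw [hRa, hRs]
    have hsliceQ : (fun y' : EuclideanSpace ℝ (Fin 3) => Q₀ (NormedSpace.exp ((-(κ * s + θ₀)) • B) y')) =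
        fun y' => Q₀ (R.symm y') := funext fun y' => by rw [hRs]
    set z : EuclideanSpace ℝ (Fin 3) := R.symm y with hz
    -- the time derivative
    have htd : timeDerivWithin univ (fun (s' : ℝ) (y' : EuclideanSpace ℝ (Fin 3)) =>
        NormedSpace.exp ((κ * s' + θ₀) • B) (W₀ (NormedSpace.exp ((-(κ * s' + θ₀)) • B) y'))) s y =
        R ((κ • B) (W₀ z) - fderiv ℝ W₀ z ((κ • B) z)) := by
      rw [timeDerivWithin_apply, derivWithin_univ, (hasDerivAt_orbit (κ := κ) (θ₀ := θ₀) (B := B) hW₀d s y).deriv,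
        hRa, hz, hRs]
    -- the spatial terms (isometry covariance)
    have hD : fderiv ℝ (fun y' => R (W₀ (R.symm y'))) y y = R (fderiv ℝ W₀ z z) := by
      rw [fderiv_conj_linearIsometryEquiv, hz]
      rfl
    have hC : convect (fun y' => R (W₀ (R.symm y'))) (fun y' => R (W₀ (R.symm y'))) y = R (fderiv ℝ W₀ z (W₀ z)) := by
      rw [convect_conj_linearIsometryEquiv, convect_apply, hz]
    have hG : gradient (fun y' => Q₀ (R.symm y')) y = R (gradient Q₀ z) := by
      rw [gradient_comp_linearIsometryEquiv_symm, hz]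
    have hΔ : (Δ fun y' => R (W₀ (R.symm y'))) y = R ((Δ W₀) z) := by
      rw [laplacian_conj_linearIsometryEquiv, hz]
    -- the profile system, rearranged
    have key : ((κ • B) (W₀ z) - fderiv ℝ W₀ z ((κ • B) z)) + (1 / 2 : ℝ) • W₀ z + (1 / 2 : ℝ) • fderiv ℝ W₀ z z
        + fderiv ℝ W₀ z (W₀ z) + gradient Q₀ z = ν • (Δ W₀) z := by
      have h := heq z
      rw [convect_apply] at h
      rw [← sub_eq_zero, ← h]
      abel
    have hsmν : ν • R ((Δ W₀) z) = R (ν • (Δ W₀) z) := (R.map_smul ν _).symm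
    rw [htd, hslice, hsliceQ, hD, hC, hG, hΔ, hRa, hRs y, ← hz, hsmν, ← key]
    simp only [map_add, LinearIsometryEquiv.map_smul]
  · obtain ⟨L, hL, hLs⟩ := rss_exists_rot hB (κ * s + θ₀)
    set R : EuclideanSpace ℝ (Fin 3) ≃ₗᵢ[ℝ] EuclideanSpace ℝ (Fin 3) := L.symm with hR
    have hRa : ∀ v, NormedSpace.exp ((κ * s + θ₀) • B) v = R v := fun v => (hLs v).symm
    have hRs : ∀ v, NormedSpace.exp ((-(κ * s + θ₀)) • B) v = R.symm v := fun v => by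
      rw [hR, LinearIsometryEquiv.symm_symm]; exact (hL v).symm
    have hslice : (fun y' : EuclideanSpace ℝ (Fin 3) =>
        NormedSpace.exp ((κ * s + θ₀) • B) (W₀ (NormedSpace.exp ((-(κ * s + θ₀)) • B) y'))) =
        fun y' => R (W₀ (R.symm y')) := funext fun y' => by rw [hRa, hRs]
    show VectorCalculus.IsDivFree (fun y' : EuclideanSpace ℝ (Fin 3) =>
        NormedSpace.exp ((κ * s + θ₀) • B) (W₀ (NormedSpace.exp ((-(κ * s + θ₀)) • B) y')))
    rw [hslice]
    exact hdiv.conj_linearIsometryEquiv R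

end Orbit

/-! ## §3 The physical field of a general-frame profile -/

section Physical

variable {ν a : ℝ} {B : EuclideanSpace ℝ (Fin 3) →L[ℝ] EuclideanSpace ℝ (Fin 3)}
  {U : EuclideanSpace ℝ (Fin 3) → EuclideanSpace ℝ (Fin 3)} {P : EuclideanSpace ℝ (Fin 3) → ℝ}
  {u : ℝ → EuclideanSpace ℝ (Fin 3) → EuclideanSpace ℝ (Fin 3)}

/-- The scale of the physical field: `λ(t) = (√(2a(0 − t)))⁻¹ = (√(2a))⁻¹ (√(−t))⁻¹`. [folklore] -/
theorem scale_eq (ha : 0 < a) (t : ℝ) :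
    (Real.sqrt (2 * a * (0 - t)))⁻¹ = (Real.sqrt (-t))⁻¹ * (Real.sqrt (2 * a))⁻¹ := by
  rw [zero_sub, Real.sqrt_mul (by positivity : (0 : ℝ) ≤ 2 * a), mul_inv, mul_comm]

/-- The angle of the physical field read in similarity time: for `t < 0` and `s = −log(−t)`,
`(√(2a))⁻² s − (√(2a))⁻² log(2a) = a⁻¹ log λ(t)`. [folklore] -/
theorem angle_eq (ha : 0 < a) {t : ℝ} (ht : t < 0) :
    (Real.sqrt (2 * a))⁻¹ * (Real.sqrt (2 * a))⁻¹ * (-Real.log (-t)) +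
        -((Real.sqrt (2 * a))⁻¹ * (Real.sqrt (2 * a))⁻¹ * Real.log (2 * a)) =
      a⁻¹ * Real.log (Real.sqrt (2 * a * (0 - t)))⁻¹ := by
  have h2a : 0 < 2 * a := by positivity
  have ht' : 0 < -t := by linarith
  have hcc : (Real.sqrt (2 * a))⁻¹ * (Real.sqrt (2 * a))⁻¹ = (2 * a)⁻¹ := by
    rw [← mul_inv, Real.mul_self_sqrt h2a.le]
  rw [hcc, Real.log_inv, zero_sub, Real.log_sqrt (by positivity), Real.log_mul h2a.ne' ht'.ne']
  field_simp
  ring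

/-- **The physical field is the physical field of a rotating Leray orbit.**  With `c = (√(2a))⁻¹` and
`φ(s) = c²s − c² log(2a)`, the field `u(t,x) = λ e^{θB} U(λ e^{−θB} x)` (`λ = (√(2a(0−t)))⁻¹`, `θ = a⁻¹ log λ`) of stubs
S3a/S3b equals `ofLerayOrbit W` for the orbit `W(s,y) = e^{φ(s)B} (c U(c e^{−φ(s)B} y))` (both sides vanish for `t ≥ 0`).
[cite: PineauVicol2026, (1.7) (arXiv:2607.09619 p. 3)] -/
theorem physicalField_eq_ofLerayOrbit (ha : 0 < a)
    (hu : ∀ (t : ℝ) (x : EuclideanSpace ℝ (Fin 3)), u t x =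
      (Real.sqrt (2 * a * (0 - t)))⁻¹ • (NormedSpace.exp ((a⁻¹ * Real.log (Real.sqrt (2 * a * (0 - t)))⁻¹) • B))
        (U ((Real.sqrt (2 * a * (0 - t)))⁻¹ •
          (NormedSpace.exp ((-(a⁻¹ * Real.log (Real.sqrt (2 * a * (0 - t)))⁻¹)) • B)) x))) :
    u = ofLerayOrbit (fun (s : ℝ) (y : EuclideanSpace ℝ (Fin 3)) =>
      NormedSpace.exp (((Real.sqrt (2 * a))⁻¹ * (Real.sqrt (2 * a))⁻¹ * s +
          -((Real.sqrt (2 * a))⁻¹ * (Real.sqrt (2 * a))⁻¹ * Real.log (2 * a))) • B)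
        ((Real.sqrt (2 * a))⁻¹ • U ((Real.sqrt (2 * a))⁻¹ •
          NormedSpace.exp ((-((Real.sqrt (2 * a))⁻¹ * (Real.sqrt (2 * a))⁻¹ * s +
            -((Real.sqrt (2 * a))⁻¹ * (Real.sqrt (2 * a))⁻¹ * Real.log (2 * a)))) • B) y))) := by
  funext t x
  rw [hu t x, ofLerayOrbit_apply]
  rcases lt_or_ge t 0 with ht | ht
  · rw [angle_eq ha ht, map_smul, smul_smul, map_smul, smul_smul, ← scale_eq ha t,
      mul_comm ((Real.sqrt (2 * a))⁻¹) ((Real.sqrt (-t))⁻¹), ← scale_eq ha t]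
  · have h1 : Real.sqrt (2 * a * (0 - t)) = 0 := Real.sqrt_eq_zero'.2 (by nlinarith)
    have h2 : Real.sqrt (-t) = 0 := Real.sqrt_eq_zero'.2 (by linarith)
    rw [h1, h2, inv_zero, zero_smul, zero_smul]

/-- **The physical rotated self-similar field of a general-frame profile is a classical Navier–Stokes solution on
the past.**  For a smooth divergence-free solution `(U, P)` of the rotated profile system
`−νΔU + aU + aDU[y] + (BU − DU[By]) + DU[U] + ∇P = 0` (`ν, a > 0`, `B` skew; `P ∈ C¹` suffices, it is smooth by the
equation), the field `u(t,x) = λ e^{θB} U(λ e^{−θB} x)`, `λ = (√(2a(0−t)))⁻¹`, `θ = a⁻¹ log λ`, together with the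
pressure `p = ofLerayOrbitPressure Q`, `Q(s,y) = c² P(c e^{−φ(s)B} y)` (`= λ² P(λ e^{−θB} x)` at `t < 0`, see
`physicalPressure_apply`), is a classical solution of the unforced Navier–Stokes system with viscosity `ν` on the time set
`(−∞, 0)`. [cite: PineauVicol2026, (1.7)–(1.8) (arXiv:2607.09619 p. 3)] -/
theorem isClassicalNSSolutionOn_physicalField (hν : 0 < ν) (ha : 0 < a) (hU : ContDiff ℝ ∞ U) (hP : ContDiff ℝ 1 P)
    (hB : ∀ x, inner ℝ (B x) x = 0) (hdiv : VectorCalculus.IsDivFree U)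
    (heq : ∀ y, -(ν • (Δ U) y) + a • U y + a • fderiv ℝ U y y + (B (U y) - fderiv ℝ U y (B y)) +
      convect U U y + gradient P y = 0)
    (hu : ∀ (t : ℝ) (x : EuclideanSpace ℝ (Fin 3)), u t x =
      (Real.sqrt (2 * a * (0 - t)))⁻¹ • (NormedSpace.exp ((a⁻¹ * Real.log (Real.sqrt (2 * a * (0 - t)))⁻¹) • B))
        (U ((Real.sqrt (2 * a * (0 - t)))⁻¹ •
          (NormedSpace.exp ((-(a⁻¹ * Real.log (Real.sqrt (2 * a * (0 - t)))⁻¹)) • B)) x))) :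
    IsClassicalNSSolutionOn (Iio 0) ν 0 u
      (ofLerayOrbitPressure (fun (s : ℝ) (y : EuclideanSpace ℝ (Fin 3)) =>
        (Real.sqrt (2 * a))⁻¹ ^ 2 * P ((Real.sqrt (2 * a))⁻¹ •
          NormedSpace.exp ((-((Real.sqrt (2 * a))⁻¹ * (Real.sqrt (2 * a))⁻¹ * s +
            -((Real.sqrt (2 * a))⁻¹ * (Real.sqrt (2 * a))⁻¹ * Real.log (2 * a)))) • B) y))) := by
  have _ := hν
  set c : ℝ := (Real.sqrt (2 * a))⁻¹ with hc
  have h2a : 0 < 2 * a := by positivity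
  have hcpos : 0 < c := inv_pos.2 (Real.sqrt_pos.2 h2a)
  have hcc : c * c = (2 * a)⁻¹ := by rw [hc, ← mul_inv, Real.mul_self_sqrt h2a.le]
  have hP' : ContDiff ℝ ∞ P := contDiff_pressure_of_rotated hU hP heq
  -- the dilated profile `W₀ = c U(c ·)`, `Q₀ = c² P(c ·)` solves the `(ν, ½, c²B)` system
  have heq₀ := fun z => rotatedProfileSystem_dilate (ν := ν) (a := a) (ν' := ν) (a' := 1 / 2) (k := c) (c := c)
    hcpos.ne' (mul_comm ν c) (by rw [hcc]; field_simp) (B := B) heq z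
  have hsm : ContDiff ℝ ∞ (fun w : EuclideanSpace ℝ (Fin 3) => c • w) := contDiff_id.const_smul c
  have hW₀ : ContDiff ℝ ∞ (fun w : EuclideanSpace ℝ (Fin 3) => c • U (c • w)) := (hU.comp hsm).const_smul c
  have hQ₀ : ContDiff ℝ ∞ (fun w : EuclideanSpace ℝ (Fin 3) => c ^ 2 * P (c • w)) :=
    contDiff_const.mul (hP'.comp hsm)
  have hdiv₀ : VectorCalculus.IsDivFree (fun w : EuclideanSpace ℝ (Fin 3) => c • U (c • w)) := by
    intro w
    show VectorCalculus.divergence (fun w => c • U (c • w)) w = 0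
    rw [divergence_const_smul_comp_smul, hdiv (c • w), mul_zero]
  have horbit := orbit_isBackwardLeraySolutionOn (ν := ν) (κ := c * c) (θ₀ := -(c * c * Real.log (2 * a))) (B := B)
    hW₀ hQ₀ hB hdiv₀ heq₀
  have hNS := isClassicalNSSolutionOn_Iio_ofLerayOrbit_iff.2 horbit
  rw [physicalField_eq_ofLerayOrbit ha hu]
  simp only [hc, sq] at hNS ⊢
  exact hNS

/-- **The physical pressure on the past**: for `t < 0` the pressure of `isClassicalNSSolutionOn_physicalField` reads
`p(t,x) = λ² P(λ e^{−θB} x)`, `λ = (√(2a(0−t)))⁻¹`, `θ = a⁻¹ log λ`. [folklore] -/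
theorem physicalPressure_apply (ha : 0 < a) {t : ℝ} (ht : t < 0) (x : EuclideanSpace ℝ (Fin 3)) :
    ofLerayOrbitPressure (fun (s : ℝ) (y : EuclideanSpace ℝ (Fin 3)) =>
        (Real.sqrt (2 * a))⁻¹ ^ 2 * P ((Real.sqrt (2 * a))⁻¹ •
          NormedSpace.exp ((-((Real.sqrt (2 * a))⁻¹ * (Real.sqrt (2 * a))⁻¹ * s +
            -((Real.sqrt (2 * a))⁻¹ * (Real.sqrt (2 * a))⁻¹ * Real.log (2 * a)))) • B) y)) t x =
      (Real.sqrt (2 * a * (0 - t)))⁻¹ ^ 2 *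
        P ((Real.sqrt (2 * a * (0 - t)))⁻¹ •
          (NormedSpace.exp ((-(a⁻¹ * Real.log (Real.sqrt (2 * a * (0 - t)))⁻¹)) • B)) x) := by
  have ht' : 0 < -t := by linarith
  rw [ofLerayOrbitPressure_apply, angle_eq ha ht, map_smul, smul_smul,
    mul_comm ((Real.sqrt (2 * a))⁻¹) ((Real.sqrt (-t))⁻¹), ← scale_eq ha t, ← mul_assoc]
  congr 1
  rw [scale_eq ha t, mul_pow, inv_pow, inv_pow, Real.sq_sqrt ht'.le]

end Physical

end LocalEnergyRescue

end Summit.NavierStokesRegularity.NavierStokesRegularity.Theorems.CoriolisHead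

end
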